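import Summits.QuantumFields.YangMills.Theses.BackwardLiouvilleRigidity
import Summits.QuantumFields.YangMills.Theorems.BackwardLiouvilleRigidityBackwardChainLemmaAdm
import Summits.QuantumFields.YangMills.Theorems.BackwardLiouvilleRigidityBackwardStabilityAdmGronwall
import HarnessLib

/-!
# BC3 skeleton — LINE «backward-lyapunov» for the CHAINED admissible organ `BackwardStabilityAdm`
(item stmt-QuantumFields-23331, rev 7 of route-QuantumFields-BackwardLiouvilleRigidity; ym-r3-idea-1 g13, lens «control»)

`BackwardStabilityAdm` is VERBATIM the consequent of the proved chain lemma `BackwardChainLemmaAdm` (23158, ✓p660990):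
backward stability of the one-bond oscillation of `L_j := log ρ_j − log ρ′_j` over any stretch of heights `j₁ ≤ j ≤ J`
with the pair-uniform factor `exp (∑ ε + 1)`.  Two sufficient edges are kernel-checked here:

* `backwardStabilityAdm_of_oneStep` — the ONE-STEP Wilson-currency organ `OneStepBackwardContractionAdm` (crux 23156, lines
  «backward-liouville-rigidity-adm» / «organ-fibre-laplace») implies it (= p660990).  Kill-test KT-W (card
  Lines/backward_stability_adm.md §KT-W): on a class pair differing by a Wilson-exact marginal reweighting the first backward step
  re-shapes the difference into the reference trajectory's own block-spin quadratic form (relative O(1) off-Wilson content), a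
  ONE-TIME jump of `a + θ w` by a factor `≫ 1 + ε_j` — fatal for the one-step statement, harmless for the chain.  Hence:
* LINE «backward-lyapunov» — `stub_lyapunov` (XL, the K-row INSTRUMENT in FREE currency): a backward Lyapunov functional `Φ` for the
  pair on the stretch, dominated at the top by the class-limit smallness `θ ω_J`, obeying the one-step inequality
  `Φ j ≤ (1 + ε j + C Φ (j+1)) Φ (j+1) + δ j` while `Φ (j+1) ≤ w₀`, and reading out the one-bond oscillation
  `osc_j ≤ Φ j (1/θ + 2 β_j #Plaq_j)`; the intended `Φ` is `a_j + θ w_j` over presentations whose marginal profile is the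
  reference's OWN local energy density (thermal direction) — the Wilson profile being the special case that suffers KT-W —
  equivalently the SD-seminorm of `L_j` after one equilibration step;  `stub_gronwall` (M): the discrete Grönwall chain
  (port of the `claim` induction of p660990 with `V_i := Φ i`);  composition `backwardStabilityAdm_of_stubs` kernel-checked.

Sorries ONLY inside `stub_*` (3: lyapunov XL, gronwall M, oneStepAdm = item 23156 by name).  No summit, rung or crux is proved
here; YM3TorusSU2 is NOT proved.
-/

set_option autoImplicit false

namespace Summit.QuantumFields.YangMills.Cruxes.BackwardStabilityAdm.BackwardLyapunov

open Summit.QuantumFields.YangMills.Theses.BackwardLiouvilleRigidity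
open scoped BigOperators Topology
open Filter MeasureTheory

/-- stub (XL, K-row / INSTRUMENT): a backward Lyapunov functional in free currency for admissible class trajectory pairs. -/
theorem stub_lyapunov : open MeasureTheory Filter Topology Literature.MathematicalPhysics.QuantumFieldTheory.Balaban1983to89 T3ContinuumYM3Torus T3NestedUnitLaws T3UnitLawDensityEML T4Continuum BalabanUVClass T3UnitScaleTilt in ∃ γ₁ : ℝ, 0 < γ₁ ∧ ∀ (F : T3Family) (γ : ℝ), 0 < γ → γ ≤ γ₁ → ∀ (b₀ p₀ κ : ℝ) (j₀ : ℕ) (prm : ℕ → ClassParams) (ω η : ℕ → ℝ), 0 < b₀ → 0 < p₀ → AdmissibleClassParams F γ b₀ p₀ prm → 0 < κ → (∀ j, 0 ≤ ω j ∧ 0 ≤ η j) → Summable η → ∀ (μ μ' : ((j : ℕ) → MeasureTheory.Measure (GaugeField (F.P j) 0 ↥(Matrix.specialUnitaryGroup (Fin 2) ℂ)))) (ρ ρ' : ((j : ℕ) → GaugeField (F.P j) 0 ↥(Matrix.specialUnitaryGroup (Fin 2) ℂ) → ℝ)), (∀ j : ℕ, IsProbabilityMeasure (μ j) ∧ μ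 j = Measure.map (descend F ℰp j) (μ (j + 1))) → (∀ j : ℕ, IsProbabilityMeasure (μ' j) ∧ μ' j = Measure.map (descend F ℰp j) (μ' (j + 1))) → (∀ j : ℕ, j₀ ≤ j → ((∀ U, PlaqSmall (θBal F.L γ b₀ p₀ j) U → 0 < ρ j U ∧ 0 < ρ' j U) ∧ μ j = (fieldMeasure _ _ _).withDensity (fun U => ENNReal.ofReal (ρ j U)) ∧ μ' j = (fieldMeasure _ _ _).withDensity (fun U => ENNReal.ofReal (ρ' j U)) ∧ MemAtHeight F ℰp j (prm j) (ρ j) ∧ MemAtHeight F ℰp j (prm j) (ρ' j) ∧ (∀ (b b' : PBond (F.P j) 0) U V W Z, PlaqSmall (θBal F.L γ b₀ p₀ j) U → PlaqSmall (θBal F.L γ b₀ p₀ j) V → PlaqSmall (θBal F.L γ b₀ p₀ j) W → PlaqSmall (θBal F.L γ b₀ p₀ j) Z → (∀ e, e ≠ b → U e = V e) → (∀ e, e ≠ b' → U e = W e) → (∀ e, e ≠ b' → V e = Z e) → (∀ e, e ≠ b → W e = Z e) → |(Real.log (ρ j U) - Real.log (ρ' j U)) - (Real.log (ρ j V) - Real.log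 (ρ' j V)) - ((Real.log (ρ j W) - Real.log (ρ' j W)) - (Real.log (ρ j Z) - Real.log (ρ' j Z)))| ≤ ω j * Real.exp (-(κ * (b.src.tdist b'.src : ℝ)))) ∧ μ j {U | ¬ PlaqSmall (θBal F.L γ b₀ p₀ j) U} ≤ ENNReal.ofReal (η j) ∧ μ' j {U | ¬ PlaqSmall (θBal F.L γ b₀ p₀ j) U} ≤ ENNReal.ofReal (η j) ∧ (ContinuousOn (ρ j) {U | PlaqSmall (θBal F.L γ b₀ p₀ j) U} ∧ ContinuousOn (ρ' j) {U | PlaqSmall (θBal F.L γ b₀ p₀ j) U}))) → ∃ (θ C w₀ : ℝ) (ε δ : ℕ → ℝ) (j₁ : ℕ), 0 < θ ∧ 0 ≤ C ∧ 0 < w₀ ∧ (∀ j, 0 ≤ ε j ∧ 0 ≤ δ j) ∧ Summable ε ∧ Summable δ ∧ Summable (fun i => ∑' k, δ (k + i)) ∧ Tendsto (fun j => (∑' k, δ (k + j)) * ((1 + 2 * ((F.L : ℝ) ^ j / γ) * (Fintype.card (Plaq (F.P j) 0) : ℝ)) * (Fintype.card (PBond (F.P j) 0) : ℝ) ^ 2))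 atTop (𝓝 0) ∧ j₀ ≤ j₁ ∧ ∀ J : ℕ, j₁ ≤ J → ∃ Φ : ℕ → ℝ, (∀ j, 0 ≤ Φ j) ∧ Φ J ≤ θ * ω J ∧ (∀ j : ℕ, j₁ ≤ j → j < J → Φ (j + 1) ≤ w₀ → Φ j ≤ (1 + ε j + C * Φ (j + 1)) * Φ (j + 1) + δ j) ∧ (∀ j : ℕ, j₁ ≤ j → j ≤ J → ∀ (b : PBond (F.P j) 0) U V, PlaqSmall (θBal F.L γ b₀ p₀ j) U → PlaqSmall (θBal F.L γ b₀ p₀ j) V → (∀ e, e ≠ b → U e = V e) → |(Real.log (ρ j U) - Real.log (ρ' j U)) - (Real.log (ρ j V) - Real.log (ρ' j V))| ≤ Φ j * (1 / θ + 2 * ((F.L : ℝ) ^ j / γ) * (Fintype.card (Plaq (F.P j) 0) : ℝ))) := by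
  sorry

/-- (LANDED ✓p664897, `Theorems/BackwardLiouvilleRigidityBackwardStabilityAdmGronwall.lean`, commit 9b9fbbf8ae11 — by name below.) stub (M): discrete backward Grönwall chain — the arithmetic core of p660990 with `V_i := Φ i`, `v := θ ω_J`. -/
theorem stub_gronwall : ∀ (C w₀ : ℝ) (ε δ Φ : ℕ → ℝ) (v : ℝ) (j₁ J : ℕ), 0 ≤ C → (∀ j, 0 ≤ ε j ∧ 0 ≤ δ j) → Summable ε → Summable δ → Summable (fun i => ∑' k, δ (k + i)) → (∀ j, 0 ≤ Φ j) → 0 ≤ v → Φ J ≤ v → (∀ j : ℕ, j₁ ≤ j → j < J → Φ (j + 1) ≤ w₀ → Φ j ≤ (1 + ε j + C * Φ (j + 1)) * Φ (j + 1) + δ j) → ∀ j : ℕ, j₁ ≤ j → j ≤ J → Real.exp (∑' k, ε k + 1) * (v + (∑' k, δ (k + j))) ≤ w₀ → C * (Real.exp (∑' k, ε k + 1) * ((J : ℝ) * v + (∑' i, ∑' k, δ (k + (i + j))))) ≤ 1 → Φ j ≤ Real.exp (∑' k, ε k + 1) * (v + (∑' k, δ (k + j))) :=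
  Summit.QuantumFields.YangMills.Theorems.BackwardLiouvilleRigidity.BackwardLyapunov.stub_gronwall

/-- stub (= crux item stmt-QuantumFields-23156 BY NAME, XL): the one-step Wilson-currency organ — the STRONGER sufficient edge. -/
theorem stub_oneStepAdm : OneStepBackwardContractionAdm := by
  sorry

/-- COMPOSITION (kernel-checked): LINE «backward-lyapunov» concludes the crux `BackwardStabilityAdm` BY NAME. -/
theorem backwardStabilityAdm_of_stubs :
    Summit.QuantumFields.YangMills.Theses.BackwardLiouvilleRigidity.BackwardStabilityAdm := by
  classical
  obtain ⟨γ₁, hγ₁, h1⟩ := stub_lyapunov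
  refine ⟨γ₁, hγ₁, fun F γ hγ hle b₀ p₀ κ j₀ prm ω η hb₀ hp₀ hadm hκ hpos hη μ μ' ρ ρ' hc hc' hB => ?_⟩
  obtain ⟨θ, C, w₀, ε, δ, j₁, hθ, hC, hw₀, hεδ, hεs, hδs, hDs, hdec, hj₀₁, hly⟩ :=
    h1 F γ hγ hle b₀ p₀ κ j₀ prm ω η hb₀ hp₀ hadm hκ hpos hη μ μ' ρ ρ' hc hc' hB
  refine ⟨θ, C, w₀, ε, δ, j₁, hθ, hC, hw₀, hεδ, hεs, hδs, hDs, hdec, hj₀₁,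
    fun j J hj hJj hsmall hquad b U V hU hV hUV => ?_⟩
  obtain ⟨Φ, hΦnn, hΦtop, hΦstep, hΦread⟩ := hly J (le_trans hj hJj)
  have hv0 : 0 ≤ θ * ω J := mul_nonneg hθ.le (hpos J).1
  have hΦj : Φ j ≤ Real.exp (∑' k, ε k + 1) * (θ * ω J + (∑' k, δ (k + j))) :=
    stub_gronwall C w₀ ε δ Φ (θ * ω J) j₁ J hC hεδ hεs hδs hDs hΦnn hv0 hΦtop hΦstep j hj hJj hsmall hquad
  have hfac : 0 ≤ (1 / θ + 2 * ((F.L : ℝ) ^ j / γ) *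
      (Fintype.card (Literature.MathematicalPhysics.QuantumFieldTheory.Balaban1983to89.Plaq (F.P j) 0) : ℝ)) := by
    positivity
  exact (hΦread j hj hJj b U V hU hV hUV).trans (mul_le_mul_of_nonneg_right hΦj hfac)

/-- SECOND SUFFICIENT EDGE (kernel-checked, = ✓p660990): the one-step organ (crux 23156) implies the chained organ. -/
theorem backwardStabilityAdm_of_oneStep :
    Summit.QuantumFields.YangMills.Theses.BackwardLiouvilleRigidity.BackwardStabilityAdm :=
  Summit.QuantumFields.YangMills.Theorems.backwardLiouvilleRigidity_backwardChainLemmaAdm_proof stub_oneStepAdm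

end Summit.QuantumFields.YangMills.Cruxes.BackwardStabilityAdm.BackwardLyapunov
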